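import Mathlib.NumberTheory.LSeries.RiemannZeta
import Mathlib.NumberTheory.ArithmeticFunction.VonMangoldt
import Mathlib.NumberTheory.Harmonic.EulerMascheroni
import Mathlib.Order.Filter.AtTopBot.Basic
import Mathlib.Topology.Order.Basic
import Literature.NumberTheory.LFunctions.RiemannXi
import HarnessLib

/-!
# The arithmetic formula for Li's coefficients: archimedean ("trend") and finite ("oscillating") parts

Topic `Literature/NumberTheory/LFunctions`, next to `RiemannXi.lean` (`keiperLiCoeff`, Li's `λ_n`),
`LiCriterion.lean` (Li 1997, Thm. 1, proved) and `BombieriLagariasZeroLocation.lean` (Bombieri–Lagarias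
1999, Thm. 1, proved; its module docstring records that their Thm. 2 — the ARITHMETIC FORMULA — was
«Deliberately NOT here … printed wording not available»). This file vendors that arithmetic formula
and the two printed, RH-FREE statements about its archimedean part, AS PRINTED in three held sources
(requested by the RH criterion column LI, cell `run/shared/lean/pub/rh-li`, rungs L-D/L-P: «the object
is the law of the oscillatory arithmetic part vs the (n/2) log n + c n trend»):

* **Coffey 2005**, Math. Phys. Anal. Geom. 8, 211–255 (= arXiv:math-ph/0505052), Thm. 1, eqs.
  (10)–(11): `λ_n = −Σ_{m=1}^n C(n,m) η_{m−1} + Σ_{m=2}^n (−1)^m C(n,m)(1−2^{−m}) ζ(m) + 1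
  − (n/2)(γ + ln π + 2 ln 2)`, where `η_k = ((−1)^k/k!) lim_{N→∞} (Σ_{m≤N} Λ(m) ln^k m / m
  − ln^{k+1} N/(k+1))` are the Laurent coefficients of `−ζ'/ζ` at `s = 1`
  (`ζ'(s)/ζ(s) = −(s−1)^{−1} − Σ_p η_p (s−1)^p`, eq. (12)); Coffey's `S₁(n) := Σ_{m=2}^n (−1)^m C(n,m)
  (1−2^{−m}) ζ(m)` (eq. (16)) and `S₂(n) := −Σ_{m=1}^n C(n,m) η_{m−1}` (eq. (52)); **Thm. 2**, eq. (20):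
  `S₁(n) ≥ (n/2) ln n + (γ−1) n/2 + 1/2`, and the Corollary after it:
  `S₁(n) ≤ (n/2) ln n + (γ+1) n/2 − 1/2` (both proved there by comparing the rearranged series (17)/(19)
  with integrals; stated here for `n ≥ 2`, the range in which (16) is a non-empty sum — at `n = 1`
  the printed lower bound would read `0 ≥ γ/2` and is not meant).
* **Bombieri–Lagarias 1999**, J. Number Theory 77, 274–287, Thm. 2 — the same formula, primary NOT held
  by the store; restated by the second author in **Lagarias 2007**, Ann. Inst. Fourier 57, 1689–1740
  (= arXiv:math/0404394), Lemma 4.2 + eqs. (4.11)–(4.13): `λ_n = S_∞(n) − S_f(n) + 1` with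
  `S_∞(n) = −Σ_{j=1}^n (−1)^{j+1} C(n,j)(1−2^{−j}) ζ*(j)`, `ζ*(1) = log(4π) + γ`, `ζ*(j) = ζ(j)` (`j ≥ 2`),
  `S_f(n) = Σ_{j=1}^n C(n,j) η_{j−1}` [SECONDARY for B–L Thm. 2]. Dictionary (all three sources use
  Riemann's `ξ = ½ s(s−1)π^{−s/2}Γ(s/2)ζ(s)` up to Li's immaterial factor 2, and Li's `λ_n`, which is the
  tree's `keiperLiCoeff n`): `S_∞(n) = S₁(n) − (n/2)(γ + ln π + 2 ln 2)` (`liArchPart`),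
  Maślanka's trend `λ̄_n = S_∞(n) + 1` (`liTrend`), `S₂(n) = −S_f(n) = λ̃_n` (`liOscPart`).
* **Lagarias 2007**, Thm. 5.1 with (5.4): unconditionally `S_∞(n, π) = (N/2) n log n + C₁(π) n
  + O(N(K(π)+1))` for `n ≥ K(π) = max_j |κ_j(π)|²`, implied constant absolute; for `ζ` (`N = 1`,
  `Q = 1`, `κ₁ = 0`, so `K = 0`): `S_∞(n) = ½ n log n + C₁ n + O(1)` for all `n ≥ 1`,
  `C₁ = ½(γ − 1 − log 2π) ≃ −1.1303307`. RH-FREE.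
* **Maślanka 2004** (arXiv:math/0402168), §2: the decomposition `λ_n = λ̄_n + λ̃_n` («trend» +
  «oscillations»), `λ̄_n = (1/Γ(n)) dⁿ/dsⁿ[s^{n−1} ln(π^{−s/2} Γ(1+s/2))]_{s=1}
  = 1 − (log 4π + γ) n/2 + Σ_{j=2}^n (−1)^j C(n,j)(1−2^{−j}) ζ(j)`.

## What is here

Definitions with bodies (`liArchSum` = Coffey's `S₁`, `liArchPart` = Lagarias's `S_∞(·, π_triv)`,
`liTrend` = Maślanka's `λ̄`, `liEtaSeq`/`liEta` = the B–L/Coffey `η_k` as the printed limit (via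
`limUnder`; the junk value if the limit did not exist — existence is part of the fact below),
`liOscPart` = Coffey's `S₂` = Maślanka's `λ̃`, `liC1` = Lagarias's `C₁(π_triv)`), their unfolding
lemmas, and three NAMED FACTS (D-0014), each RH-FREE (statements about finite sums of zeta values and
prime sums; no hypothesis on zeros):
`Coffey2005_thm1` (arithmetic formula), `Coffey2005_thm2` (explicit two-sided bounds for `S₁`),
`Lagarias2007_thm51_zeta` (the `O(1)` asymptotic of `S_∞`). Discharging them (`_holds`) is open work:
`Coffey2005_thm2` is elementary real analysis (est. 150–300 lines via (19) and an integral comparison);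
`Lagarias2007_thm51_zeta` follows from `Coffey2005_thm2`-type estimates only up to the linear term, its
`O(1)` needs Lagarias's Lemmas 5.1–5.2 (or Coffey's App. L Euler–Maclaurin); `Coffey2005_thm1` needs the
Laurent expansion of `ζ'/ζ` at `1` in terms of `Λ` and the Taylor coefficients of `log Γ(s/2)` at `1`
(`ψ(1/2) = −γ − 2 ln 2`, `ψ^{(n)}(1/2) = (−1)^{n+1} n! (2^{n+1}−1) ζ(n+1)`, Coffey (15)), none of which is
in Mathlib v4.32 in this form.

## Deliberately NOT here

Conjectures: Coffey 2005 Conj. 1–3 (sign alternation and `|η_k| ≤ γ 2^{−k}`; `|S₂| ≤ 3γ + C₂ n^{1/2+ε}`;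
hence `λ_n ≥ 0` for `n > 34`) — CONJECTURES, of RH strength (by Lagarias 2007 (1.15) and B–L Thm. 1(c) a
bound `S_f(n) = o(n)` is already RH-flavoured); Keiper's heuristic `λ_n/n ≈ ½(log n − log 2π + γ − 1)`;
Arias de Reyna 2011 (a precise form of it is EQUIVALENT to RH); Maślanka's empirical expansion
`λ̄_n ≈ ½ n ln n + C₁ n + ¾ − 1/(24n) + …` (a fit, «formally divergent»). Lagarias 2007 Thm. 6.1
(`S_f(n) = λ_n(√n) + O(√n log n)` with the incomplete Li coefficient) is a statement about zeros and is
left to the zero-side files (`Equivalents.lean`, `KeiperLiPositivityUpTo.lean`).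

## References

* [Coffey2005LiCriterion] M. W. Coffey, *Toward verification of the Riemann hypothesis: application of
  the Li criterion*, Math. Phys. Anal. Geom. 8 (2005) 211–255, Thm. 1 (eqs. (10)–(12), (16)), Thm. 2
  (eq. (20)) and its Corollary, eq. (52).
* [BombieriLagarias1999] E. Bombieri, J. C. Lagarias, J. Number Theory 77 (1999) 274–287, Thm. 2.
* [Lagarias2007LiCoefficients] J. C. Lagarias, *Li coefficients for automorphic L-functions*, Ann.
  Inst. Fourier 57 (2007) 1689–1740, Lemma 4.2, (4.11)–(4.13), Thm. 5.1, (5.2)–(5.4).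
* [Maslanka2004LiCoefficients] K. Maślanka, *Effective method of computing Li's coefficients and their
  properties*, arXiv:math/0402168 (2004), §2 (the trend/oscillation decomposition).
-/

noncomputable section

open Filter Finset
open scoped Topology ArithmeticFunction.vonMangoldt

namespace Literature.NumberTheory.LFunctions

/-! ## The archimedean part -/

/-- Coffey's `S₁(n) := Σ_{m=2}^n (−1)^m C(n,m) (1 − 2^{−m}) ζ(m)` (a finite alternating binomial sum of
the real zeta values `ζ(2), …, ζ(n)`; `(1−2^{−m})ζ(m) = Σ_{k≥0} (2k+1)^{−m}`). Empty for `n ≤ 1`.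
[cite: Coffey2005LiCriterion, eq. (16)] -/
def liArchSum (n : ℕ) : ℝ :=
  ∑ m ∈ Icc 2 n, (-1 : ℝ) ^ m * (n.choose m : ℝ) * (1 - (2 : ℝ)⁻¹ ^ m) * (riemannZeta m).re

/-- Lagarias's archimedean term for `ζ`: `S_∞(n, π_triv) = −Σ_{j=1}^n (−1)^{j+1} C(n,j)(1−2^{−j}) ζ*(j)`
with `ζ*(1) = log(4π) + γ`, i.e. `S_∞(n) = S₁(n) − (n/2)(γ + log π + 2 log 2)` (the `j = 1` term is
`−n·½·(log 4π + γ)` and `log 4π = log π + 2 log 2`). [cite: Lagarias2007LiCoefficients, Lemma 4.2 and eq. (4.11)] -/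
def liArchPart (n : ℕ) : ℝ :=
  liArchSum n - (n : ℝ) / 2 * (Real.eulerMascheroniConstant + Real.log Real.pi + 2 * Real.log 2)

/-- Maślanka's TREND `λ̄_n = 1 − (log 4π + γ) n/2 + Σ_{j=2}^n (−1)^j C(n,j)(1−2^{−j}) ζ(j) = S_∞(n) + 1`
(the `+1` is the contribution of the pole term, Lagarias's `δ(π_triv) = 1`).
[cite: Maslanka2004LiCoefficients, §2 (decomposition, «trend»)] -/
def liTrend (n : ℕ) : ℝ :=
  1 + liArchPart n

/-- Lagarias's constant `C₁(π_triv) = ½(γ − 1 − log 2π) ≃ −1.1303307`, the coefficient of `n` in the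
asymptotic of `S_∞(n)`. [cite: Lagarias2007LiCoefficients, eqs. (5.2), (5.4)] -/
def liC1 : ℝ :=
  (Real.eulerMascheroniConstant - 1 - Real.log (2 * Real.pi)) / 2

/-! ## The finite (prime) part -/

/-- The sequence whose limit defines `η_k` (up to the factor `(−1)^k/k!`):
`N ↦ Σ_{m=1}^N Λ(m) (log m)^k / m − (log N)^{k+1}/(k+1)`.
[cite: Coffey2005LiCriterion, eq. (11)] -/
def liEtaSeq (k N : ℕ) : ℝ :=
  (∑ m ∈ Icc 1 N, (Λ m : ℝ) * Real.log m ^ k / m) - Real.log N ^ (k + 1) / (k + 1)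

/-- The Bombieri–Lagarias / Coffey coefficients `η_k := ((−1)^k/k!) lim_{N→∞} liEtaSeq k N`, the
Laurent coefficients of `−ζ'/ζ` at `s = 1`: `ζ'(s)/ζ(s) = −(s−1)^{−1} − Σ_{p≥0} η_p (s−1)^p` (radius 3).
Defined with `limUnder` (junk value if the limit failed to exist; its existence is part of
`Coffey2005_thm1`). `η_0 = −γ`. [cite: Coffey2005LiCriterion, eqs. (11)–(12)] -/
def liEta (k : ℕ) : ℝ :=
  (-1 : ℝ) ^ k / (Nat.factorial k : ℝ) * limUnder atTop (liEtaSeq k)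

/-- Coffey's `S₂(n) := −Σ_{m=1}^n C(n,m) η_{m−1}` = Maślanka's OSCILLATING part
`λ̃_n = (1/Γ(n)) dⁿ/dsⁿ[s^{n−1} ln((s−1)ζ(s))]_{s=1}` = `−S_f(n)` in Lagarias's notation.
[cite: Coffey2005LiCriterion, eq. (52)] -/
def liOscPart (n : ℕ) : ℝ :=
  -∑ m ∈ Icc 1 n, (n.choose m : ℝ) * liEta (m - 1)

/-! ## Unfolding lemmas -/

/-- `S₁(n)` is an empty sum for `n ≤ 1`; in particular `S₁(1) = 0`. [cite: Coffey2005LiCriterion, eq. (16)] -/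
theorem liArchSum_of_le_one {n : ℕ} (hn : n ≤ 1) : liArchSum n = 0 := by
  unfold liArchSum
  rw [Finset.Icc_eq_empty (by omega), Finset.sum_empty]

/-- `S₁(2) = (3/4) ζ(2)`. [cite: Coffey2005LiCriterion, eq. (16)] -/
theorem liArchSum_two : liArchSum 2 = 3 / 4 * (riemannZeta 2).re := by
  unfold liArchSum
  rw [Finset.Icc_self, Finset.sum_singleton]
  norm_num

/-- `S_∞(n) = S₁(n) − (n/2)(γ + log π + 2 log 2)`. [cite: Lagarias2007LiCoefficients, eq. (4.11)] -/
theorem liArchPart_eq (n : ℕ) : liArchPart n =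
    liArchSum n - (n : ℝ) / 2 * (Real.eulerMascheroniConstant + Real.log Real.pi + 2 * Real.log 2) :=
  rfl

/-- `λ̄_n = 1 + S_∞(n)`. [cite: Maslanka2004LiCoefficients, §2] -/
theorem liTrend_eq (n : ℕ) : liTrend n = 1 + liArchPart n := rfl

/-- `S₂(n) = −Σ_{m=1}^n C(n,m) η_{m−1}`. [cite: Coffey2005LiCriterion, eq. (52)] -/
theorem liOscPart_eq (n : ℕ) :
    liOscPart n = -∑ m ∈ Icc 1 n, (n.choose m : ℝ) * liEta (m - 1) := rfl

/-! ## The named facts (RH-free, as printed) -/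

/-- **Coffey 2005, Thm. 1 (eqs. (10)–(11)) = Bombieri–Lagarias 1999, Thm. 2 = Lagarias 2007,
Lemma 4.2 + (4.11)–(4.13)** (the ARITHMETIC FORMULA for Li's coefficients), RH-FREE:
(i) for every `k` the limit `lim_{N→∞} (Σ_{m≤N} Λ(m) ln^k m/m − ln^{k+1}N/(k+1))` defining `η_k` exists,
and (ii) for every `n ≥ 1`,
`λ_n = −Σ_{m=1}^n C(n,m) η_{m−1} + Σ_{m=2}^n (−1)^m C(n,m)(1−2^{−m})ζ(m) + 1 − (n/2)(γ + ln π + 2 ln 2)`,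
i.e. `keiperLiCoeff n = liTrend n + liOscPart n` (trend + oscillation). Named fact, not proved here
(needs the Laurent expansion of `ζ'/ζ` at `1` via `Λ` and `ψ^{(n)}(1/2)`; Coffey (12)–(15)). Users take
`(h : Coffey2005_thm1)`. [cite: Coffey2005LiCriterion, Thm. 1, eqs. (10)–(11)] -/
def Coffey2005_thm1 : Prop :=
  (∀ k : ℕ, ∃ L : ℝ, Tendsto (liEtaSeq k) atTop (𝓝 L)) ∧
    ∀ n : ℕ, 1 ≤ n → keiperLiCoeff n = liTrend n + liOscPart n

/-- **Coffey 2005, Thm. 2 (eq. (20)) and its Corollary**, RH-FREE explicit two-sided bounds for the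
archimedean sum: for `n ≥ 2`,
`(n/2) ln n + (γ−1) n/2 + 1/2 ≤ S₁(n) ≤ (n/2) ln n + (γ+1) n/2 − 1/2`
(printed: «S₁(n) ≥ (n/2) ln n + (γ−1)(n/2) + 1/2» (20); «Similarly … S₁(n) ≤ (n/2) ln n + (γ+1)n/2 − 1/2»;
the range `n ≥ 2` is the range of definition (16) of `S₁` — at `n = 1`, `S₁ = 0 < γ/2`). Elementary (Coffey:
rearrangement (17)/(19), monotonicity in `k`, `I₁(n) = (n/2)[ψ(n)+γ−1] + ½`, (21)–(24)); named fact,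
not proved here. Users take `(h : Coffey2005_thm2)`. [cite: Coffey2005LiCriterion, Thm. 2 (eq. (20)) and Corollary] -/
def Coffey2005_thm2 : Prop :=
  ∀ n : ℕ, 2 ≤ n →
    (n : ℝ) / 2 * Real.log n + (Real.eulerMascheroniConstant - 1) * n / 2 + 1 / 2 ≤ liArchSum n ∧
      liArchSum n ≤ (n : ℝ) / 2 * Real.log n + (Real.eulerMascheroniConstant + 1) * n / 2 - 1 / 2

/-- **Lagarias 2007, Thm. 5.1 with (5.3)–(5.4), case `π = π_triv` (the Riemann zeta function)**, RH-FREE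
(«In this section we obtain an unconditional result for `S_∞(n,π)`»): there is an (absolute) constant `A`
such that for every `n ≥ 1`, `|S_∞(n) − (½ n log n + C₁ n)| ≤ A`, `C₁ = ½(γ − 1 − log 2π)`
(printed: `S_∞(n,π) = (N/2) n log n + C₁(π) n + O(N(K(π)+1))` for `n ≥ K(π) = max_j |κ_j(π)|²`, the implied
constant absolute; for `ζ`, `N = 1`, `Q(π) = 1`, `κ₁ = 0`). Named fact, not proved here. Users take
`(h : Lagarias2007_thm51_zeta)`. [cite: Lagarias2007LiCoefficients, Thm. 5.1 and eq. (5.4)] -/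
def Lagarias2007_thm51_zeta : Prop :=
  ∃ A : ℝ, ∀ n : ℕ, 1 ≤ n → |liArchPart n - ((n : ℝ) / 2 * Real.log n + liC1 * n)| ≤ A

/-! ## Immediate consequences (proved) -/

/-- Under the arithmetic formula, the oscillating part is `λ_n − λ̄_n`. [cite: Coffey2005LiCriterion, Thm. 1] -/
theorem liOscPart_eq_sub (h : Coffey2005_thm1) {n : ℕ} (hn : 1 ≤ n) :
    liOscPart n = keiperLiCoeff n - liTrend n := by
  rw [h.2 n hn]; ring

/-- From Lagarias's `O(1)` law for `S_∞`: the trend satisfies `|λ̄_n − (½ n log n + C₁ n)| ≤ A + 1` with the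
same constant `A`. [cite: Lagarias2007LiCoefficients, Thm. 5.1] -/
theorem liTrend_sub_le (h : Lagarias2007_thm51_zeta) :
    ∃ A : ℝ, ∀ n : ℕ, 1 ≤ n → |liTrend n - ((n : ℝ) / 2 * Real.log n + liC1 * n)| ≤ A + 1 := by
  obtain ⟨A, hA⟩ := h
  refine ⟨A, fun n hn => ?_⟩
  have h1 := hA n hn
  rw [liTrend_eq]
  calc |1 + liArchPart n - ((n : ℝ) / 2 * Real.log n + liC1 * n)|
      = |(liArchPart n - ((n : ℝ) / 2 * Real.log n + liC1 * n)) + 1| := by ring_nf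
    _ ≤ |liArchPart n - ((n : ℝ) / 2 * Real.log n + liC1 * n)| + |(1 : ℝ)| := abs_add_le _ _
    _ ≤ A + 1 := by rw [abs_one]; linarith

/-- Under the arithmetic formula and Coffey's lower bound: for `n ≥ 2`,
`λ_n ≥ (n/2) ln n − (n/2)(1 + ln π + 2 ln 2) + 3/2 − |S₂(n)|` (Coffey's Corollary, first clause, as a
consequence of the two facts). [cite: Coffey2005LiCriterion, Corollary after Thm. 2] -/
theorem keiperLiCoeff_ge_of_coffey (h1 : Coffey2005_thm1) (h2 : Coffey2005_thm2) {n : ℕ} (hn : 2 ≤ n) :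
    (n : ℝ) / 2 * Real.log n - (n : ℝ) / 2 * (1 + Real.log Real.pi + 2 * Real.log 2) + 3 / 2
        - |liOscPart n| ≤ keiperLiCoeff n := by
  have hform := h1.2 n (by omega)
  have hlow := (h2 n hn).1
  have habs : -|liOscPart n| ≤ liOscPart n := neg_abs_le _
  rw [hform, liTrend_eq, liArchPart_eq]
  nlinarith [hlow, habs]

end Literature.NumberTheory.LFunctions

end
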